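import Summits.CriticalPhenomena.CardyFormulaZ2.Theorems.CardyComplexConeEdgePrecompactUFRSStrandsHpArmsPureArms
import Summits.CriticalPhenomena.CardyFormulaZ2.Theorems.CardyComplexConeEdgePrecompactUFRSStrandsHpArmsPureRegion
import Summits.CriticalPhenomena.CardyFormulaZ2.Theorems.CardyComplexConeEdgePrecompactUFRSStrandsHpArmsPureSideFrames
import Summits.CriticalPhenomena.CardyFormulaZ2.Theorems.CardyComplexConeEdgePrecompactUFRSStrandsHpArmsPureDictionary

/-!
# Three strands of one completion ⇒ three loose half-plane arms (HT-A, pure case)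
(line `qkz-strip-boundary-arm` of crux `CardyComplexCone.EdgePrecompact`, stmt-CriticalPhenomena-11387;
the registered sub-goal `ufrs_rect_strandsHpArms_pure`, deterministic half of the flat
three-strand decay HT in the PURE case — three strands of ONE completed configuration)

**Theorem** (`ufrs_rect_strandsHpArms_pure`). For a rectangle of side lengths `Lx, Ly` there
are `K₀ ≥ 1` and `c₀ > 0` such that for every `ℤ²`-admissible Dobrushin datum `F` of a translate
of the rectangle, every `z ∈ F.Ω` with `infDist z F.Ωᶜ ≤ s`, `F.δ ≤ s`, `K₀ s ≤ S ≤ c₀`, and all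
marked edges at distance `≥ 2S` from `z`, there are a lattice frame `φ`, a base abscissa `j`, a
window `m` (`1 ≤ m`, `m δ ≤ K₀ s`) and a scale `R` (`S ≤ K₀ R δ`) such that for EVERY
configuration `ω`: three pairwise corner-disjoint simple stretches of orbits of Smirnov's successor
map of `F.bcBondConfig ω` through inner faces of `F`, each joining the `s`-ball of `z` to distance
`≥ S`, force `relabel φ ω ∈ hpLooseArms j 3 m R` — three loose genuine arms of `ω` of two colours
in the upright half-plane (`…UFRSHalfPlaneArms.lean`), the input format of the probabilistic half
`hpLooseArms_three_decay_of_two ∘ hpLooseArms_two_decay`.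

**Proof** (assembled from parts I–VII). The discrete boundary within `S` of `z` is monochromatic
(`ufrs_rect_boundaryMonochromatic`). Rescale to mesh `1`; choose the sector radius
`R₁ ∈ {R/2, R/6}` (`adapt_HTP`) so that the exterior of the shrunk lattice box inside the annulus
`(s/δ + 1/2, R₁ - 1/2)` is preconnected (`annulus_exterior_preconnected`); the exterior-set sector
argument gives three genuine arms of `ω` in lattice coordinates (`rect_threeArms`, WIRED / FREE);
the frame of the side of the rectangle within `s` of `z` (`frameB/T/L/R`) and the framing lemma
`frame_hpLooseArms_HTP` (transport and trimming) give the loose arms.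

References: G. F. Lawler, O. Schramm, W. Werner, Electron. J. Probab. 7 (2002), Appendix A;
M. Aizenman, A. Burchard, Duke Math. J. 99 (1999), Appendix A; S. Smirnov, C. R. Acad. Sci. Paris
333 (2001), §2.
-/

namespace Summit.CriticalPhenomena.CardyFormulaZ2.Cruxes.EdgePrecompact.QkzStripBoundaryArm

open MeasureTheory Filter Set Metric Complex
open scoped Topology BigOperators Pointwise
open Literature.Probability.LatticeModels Literature.Probability.Percolation
open Literature.Probability.RandomPlanarGeometry (DobrushinDomain)
open Summit.CriticalPhenomena.CardyFormulaZ2.Theses.CardyComplexCone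

noncomputable section

/-! ## The arms of one configuration at mesh `1` -/

/-- **Three genuine arms from three strands of `F.bcBondConfig ω`** (rectangle datum, mesh-`1`
coordinates about `z/δ`): the dictionary of `…PureDictionary.lean` fed into `rect_threeArms`. -/
theorem arms_mesh_one_HTP {x₀ x₁ y₀ y₁ : ℝ} {F : DiscreteDobrushin} (hF : F.IsZdAdmissible)
    (hΩ : F.Ω = Set.Ioo x₀ x₁ ×ℂ Set.Ioo y₀ y₁) (z : ℂ) {s S r R R₁ : ℝ}
    (hr : r = s / F.δ) (hR : R = S / F.δ) (hr0 : 0 ≤ r) (hrR : r + 16 ≤ R₁) (hR₁R : R₁ ≤ R)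
    (hcol : (∀ x ∈ F.zdArcA, S < dist (meshPoint F.δ x) z) ∨ (∀ x ∈ F.zdArcB, S < dist (meshPoint F.δ x) z))
    (hZc : IsPreconnected (exteriorSet ((F.δ : ℂ)⁻¹ * z) r R₁ (⌊x₀ / F.δ⌋ + 1) (⌈x₁ / F.δ⌉ - 1) (⌊y₀ / F.δ⌋ + 1) (⌈y₁ / F.δ⌉ - 1)))
    (ω : BondConfig (Site 2))
    (hω : ∃ (c : Fin 3 → Site 2 × Fin 4) (i j : Fin 3 → ℕ), (∀ a, i a ≤ j a ∧
      ((dist (meshPoint F.δ (cornerOrbit (F.bcBondConfig ω) (c a) (i a)).1) z ≤ s ∧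
          S ≤ dist (meshPoint F.δ (cornerOrbit (F.bcBondConfig ω) (c a) (j a)).1) z) ∨
        (S ≤ dist (meshPoint F.δ (cornerOrbit (F.bcBondConfig ω) (c a) (i a)).1) z ∧
          dist (meshPoint F.δ (cornerOrbit (F.bcBondConfig ω) (c a) (j a)).1) z ≤ s)) ∧
      (∀ t, i a ≤ t → t ≤ j a → F.IsInnerFace (cFace (cornerOrbit (F.bcBondConfig ω) (c a) t))) ∧
      (∀ s' t, i a ≤ s' → s' < t → t ≤ j a → cornerOrbit (F.bcBondConfig ω) (c a) s' ≠ cornerOrbit (F.bcBondConfig ω) (c a) t)) ∧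
      (∀ a b, a ≠ b → ∀ s' t, i a ≤ s' → s' ≤ j a → i b ≤ t → t ≤ j b →
        cornerOrbit (F.bcBondConfig ω) (c a) s' ≠ cornerOrbit (F.bcBondConfig ω) (c b) t)) :
    ∃ (κ : Fin 3 → Bool) (x y : Fin 3 → Site 2) (W : ∀ a, (zdGraph 2).Walk (x a) (y a)),
      (∃ a b, κ a ≠ κ b) ∧
      (∀ a, dist (Site.toComplex (x a)) ((F.δ : ℂ)⁻¹ * z) ≤ r + 4 ∧ R₁ - 4 ≤ dist (Site.toComplex (y a)) ((F.δ : ℂ)⁻¹ * z) ∧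
        (κ a = true → (∀ u ∈ (W a).support, u ∈ meshVertices F.Ω F.δ) ∧ ∀ e ∈ (W a).edges, e ∈ ω) ∧
        (κ a = false → (∀ g ∈ (W a).support, F.IsInnerFace g) ∧ ∀ d ∈ (W a).darts, sepEdge d.fst d.snd ∉ ω)) ∧
      Pairwise (fun a b => κ a = κ b → (κ a = true → ∀ e ∈ (W a).edges, e ∉ (W b).edges) ∧
        (κ a = false → ∀ d ∈ (W a).darts, ∀ d' ∈ (W b).darts, sepEdge d.fst d.snd ≠ sepEdge d'.fst d'.snd)) := by
  have hδ := hF.delta_pos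
  set z' : ℂ := (F.δ : ℂ)⁻¹ * z with hz'
  have hdist : ∀ v : Site 2, dist (meshPoint F.δ v) z = F.δ * dist (Site.toComplex v) z' :=
    fun v => dist_meshPoint_eq_HTP hδ v z
  have hle : ∀ (v : Site 2) (b : ℝ), dist (meshPoint F.δ v) z ≤ b → dist (Site.toComplex v) z' ≤ b / F.δ := by
    intro v b h; rw [hdist] at h; rw [le_div_iff₀ hδ, mul_comm]; exact h
  have hge : ∀ (v : Site 2) (b : ℝ), b ≤ dist (meshPoint F.δ v) z → b / F.δ ≤ dist (Site.toComplex v) z' := by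
    intro v b h; rw [hdist] at h; rw [div_le_iff₀ hδ, mul_comm]; exact h
  obtain ⟨c, i, j, hstr, hdis⟩ := hω
  have hcol' : (∀ x ∈ F.zdArcA, R ≤ dist (Site.toComplex x) z') ∨ (∀ x ∈ F.zdArcB, R ≤ dist (Site.toComplex x) z') := by
    rcases hcol with h | h
    · exact Or.inl fun x hx => by rw [hR]; exact hge x S (h x hx).le
    · exact Or.inr fun x hx => by rw [hR]; exact hge x S (h x hx).le
  exact rect_threeArms (meshVertices F.Ω F.δ) (⌊x₀ / F.δ⌋ + 1) (⌈x₁ / F.δ⌉ - 1) (⌊y₀ / F.δ⌋ + 1) (⌈y₁ / F.δ⌉ - 1)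
    (box_mem_iff_HTP hF hΩ) F.IsInnerFace (fun g hg => innerFace_bounds_HTP hF hΩ hg) F.zdArcA F.zdArcB
    (arcs_on_sides_HTP hF hΩ) (F.bcBondConfig ω) ω (bc_open_cases_HTP hF ω)
    (bc_closed_cases_HTP ω) (bc_closed_of_arcB_HTP hF ω) z' hr0 hrR hR₁R hcol' hZc c i j (fun a => (hstr a).1)
    (fun a => ((hstr a).2.1).imp (fun h => ⟨by rw [hr]; exact hle _ _ h.1, hR₁R.trans (by rw [hR]; exact hge _ _ h.2)⟩)
      (fun h => ⟨hR₁R.trans (by rw [hR]; exact hge _ _ h.1), by rw [hr]; exact hle _ _ h.2⟩))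
    (fun a t h1 h2 => (hstr a).2.2.1 t h1 h2) hdis

/-! ## The four frame specifications of a rectangle datum -/

section Specs

variable {x₀ x₁ y₀ y₁ : ℝ} {F : DiscreteDobrushin}

/-- Frame specification of the LEFT side (input of `frame_hpLooseArms_HTP`). -/
theorem frameSpecL_HTP (hF : F.IsZdAdmissible) (hΩ : F.Ω = Set.Ioo x₀ x₁ ×ℂ Set.Ioo y₀ y₁) (j : ℤ) :
    (∀ g g' : Site 2, (zdGraph 2).Adj g g' → sepEdge (frameL (⌊x₀ / F.δ⌋ + 1) g) (frameL (⌊x₀ / F.δ⌋ + 1) g') =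
      Sym2.map (frameL (⌊x₀ / F.δ⌋ + 1)) (sepEdge g g')) ∧
    (∀ u v : Site 2, |frameL (⌊x₀ / F.δ⌋ + 1) u 0 - frameL (⌊x₀ / F.δ⌋ + 1) v 0| = |u 1 - v 1|) ∧
    (∀ u v : Site 2, |frameL (⌊x₀ / F.δ⌋ + 1) u 1 - frameL (⌊x₀ / F.δ⌋ + 1) v 1| = |u 0 - v 0|) ∧
    (∀ g : Site 2, frameL (⌊x₀ / F.δ⌋ + 1) g 0 = frameL (⌊x₀ / F.δ⌋ + 1) g 0 ∧
      (frameL (⌊x₀ / F.δ⌋ + 1) g 1 = frameL (⌊x₀ / F.δ⌋ + 1) g 1 ∨ frameL (⌊x₀ / F.δ⌋ + 1) g 1 = frameL (⌊x₀ / F.δ⌋ + 1) g 1 - 1)) ∧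
    (∀ u ∈ meshVertices F.Ω F.δ, 0 ≤ frameL (⌊x₀ / F.δ⌋ + 1) u 1) ∧
    (∀ g, F.IsInnerFace g → 0 ≤ frameL (⌊x₀ / F.δ⌋ + 1) g 1) ∧
    (frameL (⌊x₀ / F.δ⌋ + 1) ![⌊x₀ / F.δ⌋ + 1, j] 0 = j ∧ frameL (⌊x₀ / F.δ⌋ + 1) ![⌊x₀ / F.δ⌋ + 1, j] 1 = 0) := by
  set a₀ : ℤ := ⌊x₀ / F.δ⌋ + 1 with ha₀
  refine ⟨compat_frameL a₀, fun u v => ?_, fun u v => ?_, fun g => ⟨rfl, Or.inl rfl⟩, fun u hu => ?_, fun g hg => ?_, ?_⟩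
  · rw [(frameL_apply a₀ u).1, (frameL_apply a₀ v).1]
  · rw [(frameL_apply a₀ u).2, (frameL_apply a₀ v).2]; congr 1; ring
  · rw [(frameL_apply a₀ u).2]; have := (box_mem_iff_HTP hF hΩ u).1 hu; omega
  · rw [(frameL_apply a₀ g).2]; have := innerFace_bounds_HTP hF hΩ hg; omega
  · rw [(frameL_apply a₀ _).1, (frameL_apply a₀ _).2]; simp

/-- Frame specification of the RIGHT side. -/
theorem frameSpecR_HTP (hF : F.IsZdAdmissible) (hΩ : F.Ω = Set.Ioo x₀ x₁ ×ℂ Set.Ioo y₀ y₁) (j : ℤ) :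
    (∀ g g' : Site 2, (zdGraph 2).Adj g g' → sepEdge (faceR (⌈x₁ / F.δ⌉ - 1) g) (faceR (⌈x₁ / F.δ⌉ - 1) g') =
      Sym2.map (frameR (⌈x₁ / F.δ⌉ - 1)) (sepEdge g g')) ∧
    (∀ u v : Site 2, |frameR (⌈x₁ / F.δ⌉ - 1) u 0 - frameR (⌈x₁ / F.δ⌉ - 1) v 0| = |u 1 - v 1|) ∧
    (∀ u v : Site 2, |frameR (⌈x₁ / F.δ⌉ - 1) u 1 - frameR (⌈x₁ / F.δ⌉ - 1) v 1| = |u 0 - v 0|) ∧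
    (∀ g : Site 2, faceR (⌈x₁ / F.δ⌉ - 1) g 0 = frameR (⌈x₁ / F.δ⌉ - 1) g 0 ∧
      (faceR (⌈x₁ / F.δ⌉ - 1) g 1 = frameR (⌈x₁ / F.δ⌉ - 1) g 1 ∨ faceR (⌈x₁ / F.δ⌉ - 1) g 1 = frameR (⌈x₁ / F.δ⌉ - 1) g 1 - 1)) ∧
    (∀ u ∈ meshVertices F.Ω F.δ, 0 ≤ frameR (⌈x₁ / F.δ⌉ - 1) u 1) ∧
    (∀ g, F.IsInnerFace g → 0 ≤ faceR (⌈x₁ / F.δ⌉ - 1) g 1) ∧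
    (frameR (⌈x₁ / F.δ⌉ - 1) ![⌈x₁ / F.δ⌉ - 1, j] 0 = j ∧ frameR (⌈x₁ / F.δ⌉ - 1) ![⌈x₁ / F.δ⌉ - 1, j] 1 = 0) := by
  set a₁ : ℤ := ⌈x₁ / F.δ⌉ - 1 with ha₁
  refine ⟨compat_frameR a₁, fun u v => ?_, fun u v => ?_, fun g => ⟨?_, Or.inr ?_⟩, fun u hu => ?_, fun g hg => ?_, ?_⟩
  · rw [(frameR_apply a₁ u).1, (frameR_apply a₁ v).1]
  · rw [(frameR_apply a₁ u).2, (frameR_apply a₁ v).2, abs_sub_comm (u 0)]; congr 1; ring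
  · rw [(faceR_apply a₁ g).1, (frameR_apply a₁ g).1]
  · rw [(faceR_apply a₁ g).2, (frameR_apply a₁ g).2]; ring
  · rw [(frameR_apply a₁ u).2]; have := (box_mem_iff_HTP hF hΩ u).1 hu; omega
  · rw [(faceR_apply a₁ g).2]; have := innerFace_bounds_HTP hF hΩ hg; omega
  · rw [(frameR_apply a₁ _).1, (frameR_apply a₁ _).2]; simp

/-- Frame specification of the BOTTOM side. -/
theorem frameSpecB_HTP (hF : F.IsZdAdmissible) (hΩ : F.Ω = Set.Ioo x₀ x₁ ×ℂ Set.Ioo y₀ y₁) (j : ℤ) :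
    (∀ g g' : Site 2, (zdGraph 2).Adj g g' → sepEdge (frameB (⌊y₀ / F.δ⌋ + 1) g) (frameB (⌊y₀ / F.δ⌋ + 1) g') =
      Sym2.map (frameB (⌊y₀ / F.δ⌋ + 1)) (sepEdge g g')) ∧
    (∀ u v : Site 2, |frameB (⌊y₀ / F.δ⌋ + 1) u 0 - frameB (⌊y₀ / F.δ⌋ + 1) v 0| = |u 0 - v 0|) ∧
    (∀ u v : Site 2, |frameB (⌊y₀ / F.δ⌋ + 1) u 1 - frameB (⌊y₀ / F.δ⌋ + 1) v 1| = |u 1 - v 1|) ∧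
    (∀ g : Site 2, frameB (⌊y₀ / F.δ⌋ + 1) g 0 = frameB (⌊y₀ / F.δ⌋ + 1) g 0 ∧
      (frameB (⌊y₀ / F.δ⌋ + 1) g 1 = frameB (⌊y₀ / F.δ⌋ + 1) g 1 ∨ frameB (⌊y₀ / F.δ⌋ + 1) g 1 = frameB (⌊y₀ / F.δ⌋ + 1) g 1 - 1)) ∧
    (∀ u ∈ meshVertices F.Ω F.δ, 0 ≤ frameB (⌊y₀ / F.δ⌋ + 1) u 1) ∧
    (∀ g, F.IsInnerFace g → 0 ≤ frameB (⌊y₀ / F.δ⌋ + 1) g 1) ∧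
    (frameB (⌊y₀ / F.δ⌋ + 1) ![j, ⌊y₀ / F.δ⌋ + 1] 0 = j ∧ frameB (⌊y₀ / F.δ⌋ + 1) ![j, ⌊y₀ / F.δ⌋ + 1] 1 = 0) := by
  set b₀ : ℤ := ⌊y₀ / F.δ⌋ + 1 with hb₀
  refine ⟨compat_frameB b₀, fun u v => ?_, fun u v => ?_, fun g => ⟨rfl, Or.inl rfl⟩, fun u hu => ?_, fun g hg => ?_, ?_⟩
  · rw [(frameB_apply b₀ u).1, (frameB_apply b₀ v).1]
  · rw [(frameB_apply b₀ u).2, (frameB_apply b₀ v).2]; congr 1; ring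
  · rw [(frameB_apply b₀ u).2]; have := (box_mem_iff_HTP hF hΩ u).1 hu; omega
  · rw [(frameB_apply b₀ g).2]; have := innerFace_bounds_HTP hF hΩ hg; omega
  · rw [(frameB_apply b₀ _).1, (frameB_apply b₀ _).2]; simp

/-- Frame specification of the TOP side. -/
theorem frameSpecT_HTP (hF : F.IsZdAdmissible) (hΩ : F.Ω = Set.Ioo x₀ x₁ ×ℂ Set.Ioo y₀ y₁) (j : ℤ) :
    (∀ g g' : Site 2, (zdGraph 2).Adj g g' → sepEdge (faceT (⌈y₁ / F.δ⌉ - 1) g) (faceT (⌈y₁ / F.δ⌉ - 1) g') =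
      Sym2.map (frameT (⌈y₁ / F.δ⌉ - 1)) (sepEdge g g')) ∧
    (∀ u v : Site 2, |frameT (⌈y₁ / F.δ⌉ - 1) u 0 - frameT (⌈y₁ / F.δ⌉ - 1) v 0| = |u 0 - v 0|) ∧
    (∀ u v : Site 2, |frameT (⌈y₁ / F.δ⌉ - 1) u 1 - frameT (⌈y₁ / F.δ⌉ - 1) v 1| = |u 1 - v 1|) ∧
    (∀ g : Site 2, faceT (⌈y₁ / F.δ⌉ - 1) g 0 = frameT (⌈y₁ / F.δ⌉ - 1) g 0 ∧
      (faceT (⌈y₁ / F.δ⌉ - 1) g 1 = frameT (⌈y₁ / F.δ⌉ - 1) g 1 ∨ faceT (⌈y₁ / F.δ⌉ - 1) g 1 = frameT (⌈y₁ / F.δ⌉ - 1) g 1 - 1)) ∧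
    (∀ u ∈ meshVertices F.Ω F.δ, 0 ≤ frameT (⌈y₁ / F.δ⌉ - 1) u 1) ∧
    (∀ g, F.IsInnerFace g → 0 ≤ faceT (⌈y₁ / F.δ⌉ - 1) g 1) ∧
    (frameT (⌈y₁ / F.δ⌉ - 1) ![j, ⌈y₁ / F.δ⌉ - 1] 0 = j ∧ frameT (⌈y₁ / F.δ⌉ - 1) ![j, ⌈y₁ / F.δ⌉ - 1] 1 = 0) := by
  set b₁ : ℤ := ⌈y₁ / F.δ⌉ - 1 with hb₁
  refine ⟨compat_frameT b₁, fun u v => ?_, fun u v => ?_, fun g => ⟨?_, Or.inr ?_⟩, fun u hu => ?_, fun g hg => ?_, ?_⟩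
  · rw [(frameT_apply b₁ u).1, (frameT_apply b₁ v).1]
  · rw [(frameT_apply b₁ u).2, (frameT_apply b₁ v).2, abs_sub_comm (u 1)]; congr 1; ring
  · rw [(faceT_apply b₁ g).1, (frameT_apply b₁ g).1]
  · rw [(faceT_apply b₁ g).2, (frameT_apply b₁ g).2]; ring
  · rw [(frameT_apply b₁ u).2]; have := (box_mem_iff_HTP hF hΩ u).1 hu; omega
  · rw [(faceT_apply b₁ g).2]; have := innerFace_bounds_HTP hF hΩ hg; omega
  · rw [(frameT_apply b₁ _).1, (frameT_apply b₁ _).2]; simp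

end Specs

/-! ## The registered statement -/

/-- The numerical bookkeeping of the window `m` and the scale `R'`. -/
theorem numerics_HTP (r R R₁ : ℝ) (hr1 : 1 ≤ r) (hRr : 200 * r ≤ R) (hlo : R / 6 ≤ R₁) (hhi : R₁ ≤ R / 2) :
    ∃ m R' : ℕ, 1 ≤ m ∧ (2 * r + 7 ≤ (m : ℝ)) ∧ ((m : ℝ) ≤ 200 * r) ∧ m < R' ∧ (2 * (R' : ℝ) + r + 8 ≤ R₁) ∧
      (R ≤ 200 * (R' : ℝ)) ∧ 0 ≤ r ∧ r + 16 ≤ R₁ ∧ 3 * (r + 1 / 2) < R₁ - 1 / 2 ∧ R₁ ≤ R := by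
  set m : ℕ := ⌈2 * r⌉₊ + 7 with hm
  set R' : ℕ := ⌊(R₁ - r - 8) / 2⌋₊ with hR'
  have hm1 : (2 * r + 7 : ℝ) ≤ m := by rw [hm]; push_cast; linarith [Nat.le_ceil (2 * r)]
  have hm2 : (m : ℝ) ≤ 2 * r + 8 := by
    rw [hm]; push_cast; linarith [(Nat.ceil_lt_add_one (by linarith : (0:ℝ) ≤ 2 * r)).le]
  have hR'1 : (R' : ℝ) ≤ (R₁ - r - 8) / 2 := by rw [hR']; exact Nat.floor_le (by linarith)
  have hR'2 : (R₁ - r - 8) / 2 - 1 ≤ R' := by rw [hR']; linarith [Nat.lt_floor_add_one ((R₁ - r - 8) / 2)]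
  have hmR : m < R' := by
    have : (m : ℝ) < R' := by linarith
    exact_mod_cast this
  exact ⟨m, R', by rw [hm]; omega, hm1, by linarith, hmR, by linarith, by linarith, by linarith, by linarith, by linarith,
    by linarith⟩

/-- A lattice point near the rescaled centre: `dist ≤ |Δre| + |Δim|`. -/
theorem dist_site_le_HTP (p : Site 2) (w : ℂ) :
    dist (Site.toComplex p) w ≤ |(p 0 : ℝ) - w.re| + |(p 1 : ℝ) - w.im| := by
  rw [Complex.dist_eq]
  have h := Complex.norm_le_abs_re_add_abs_im (Site.toComplex p - w)
  simpa [Complex.sub_re, Complex.sub_im] using h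

set_option maxHeartbeats 400000 in
/-- **HT-A, pure case: three corner-disjoint strands of one completion near a flat side or a convex
corner of a rectangle, away from the marked edges, give three loose genuine half-plane arms of two
colours in a lattice frame** (registered sub-goal `ufrs_rect_strandsHpArms_pure` of
stmt-CriticalPhenomena-11387; see the module docstring). -/
theorem ufrs_rect_strandsHpArms_pure : ∀ (Lx Ly : ℝ), 0 < Lx → 0 < Ly → ∃ (K₀ c₀ : ℝ), 1 ≤ K₀ ∧ 0 < c₀ ∧ ∀ (F : DiscreteDobrushin) (x₀ y₀ : ℝ), F.Ω = Set.Ioo x₀ (x₀ + Lx) ×ℂ Set.Ioo y₀ (y₀ + Ly) → F.IsZdAdmissible → ∀ (z : ℂ) (s S : ℝ), z ∈ F.Ω → infDist z F.Ωᶜ ≤ s → F.δ ≤ s → K₀ * s ≤ S → S ≤ c₀ → (∀ e₀ ∈ F.zdABEdges, 2 * S ≤ dist (medialPoint F.δ e₀) z) → ∃ (φ : zdGraph 2 ≃g zdGraph 2) (j : ℤ) (m R : ℕ), 1 ≤ m ∧ (m : ℝ) * F.δ ≤ K₀ * s ∧ S ≤ K₀ * R * F.δ ∧ ∀ ω : BondConfig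 (Site 2), (∃ (c : Fin 3 → Site 2 × Fin 4) (i j : Fin 3 → ℕ), (∀ a, i a ≤ j a ∧ ((dist (meshPoint F.δ (cornerOrbit (F.bcBondConfig ω) (c a) (i a)).1) z ≤ s ∧ S ≤ dist (meshPoint F.δ (cornerOrbit (F.bcBondConfig ω) (c a) (j a)).1) z) ∨ (S ≤ dist (meshPoint F.δ (cornerOrbit (F.bcBondConfig ω) (c a) (i a)).1) z ∧ dist (meshPoint F.δ (cornerOrbit (F.bcBondConfig ω) (c a) (j a)).1) z ≤ s)) ∧ (∀ t, i a ≤ t → t ≤ j a → F.IsInnerFace (cFace (cornerOrbit (F.bcBondConfig ω) (c a) t))) ∧ (∀ s' t, i a ≤ s' → s' < t → t ≤ j a → cornerOrbit (F.bcBondConfig ω) (c a) s' ≠ cornerOrbit (F.bcBondConfig ω) (c a) t)) ∧ (∀ a b, a ≠ b → ∀ s' t, i a ≤ s' → s' ≤ j a → i b ≤ t → t ≤ j b → cornerOrbit (F.bcBondConfig ω) (c a) s' ≠ cornerOrbit (F.bcBondConfig ω) (c b) t)) → BondConfig.relabel (sym2Equiv φ.toEquiv) ω ∈ hpLooseArms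 j 3 m R := by
  intro Lx Ly hLx hLy
  refine ⟨200, min Lx Ly / 16, by norm_num, by positivity, ?_⟩
  intro F x₀ y₀ hΩ hF z s S hzΩ hinf hδs hKs hSc hnoAB
  have hδ := hF.delta_pos
  have hs : 0 < s := lt_of_lt_of_le hδ hδs
  have hSx : S ≤ Lx / 16 := hSc.trans (by rw [div_le_div_iff_of_pos_right (by norm_num : (0:ℝ) < 16)]; exact min_le_left _ _)
  have hSy : S ≤ Ly / 16 := hSc.trans (by rw [div_le_div_iff_of_pos_right (by norm_num : (0:ℝ) < 16)]; exact min_le_right _ _)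
  -- lattice units
  set r : ℝ := s / F.δ with hr
  set R : ℝ := S / F.δ with hR
  have hr1 : 1 ≤ r := by rw [hr, le_div_iff₀ hδ, one_mul]; exact hδs
  have hRr : 200 * r ≤ R := by rw [hr, hR, ← mul_div_assoc]; exact div_le_div_of_nonneg_right hKs hδ.le
  have hδS : F.δ ≤ S := by nlinarith
  set z' : ℂ := (F.δ : ℂ)⁻¹ * z with hz'
  obtain ⟨hz're, hz'im⟩ := rescale_re_im_HTP F.δ z
  -- box integers and positions
  set a₀ : ℤ := ⌊x₀ / F.δ⌋ + 1 with ha₀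
  set a₁ : ℤ := ⌈(x₀ + Lx) / F.δ⌉ - 1 with ha₁
  set b₀ : ℤ := ⌊y₀ / F.δ⌋ + 1 with hb₀
  set b₁ : ℤ := ⌈(y₀ + Ly) / F.δ⌉ - 1 with hb₁
  have pa₀ : (a₀ : ℝ) - 1 ≤ x₀ / F.δ ∧ x₀ / F.δ < a₀ := by
    rw [ha₀]; push_cast; exact ⟨by linarith [Int.floor_le (x₀ / F.δ)], Int.lt_floor_add_one _⟩
  have pa₁ : (a₁ : ℝ) < (x₀ + Lx) / F.δ ∧ (x₀ + Lx) / F.δ ≤ a₁ + 1 := by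
    rw [ha₁]; push_cast; exact ⟨by linarith [Int.ceil_lt_add_one ((x₀ + Lx) / F.δ)], by linarith [Int.le_ceil ((x₀ + Lx) / F.δ)]⟩
  have pb₀ : (b₀ : ℝ) - 1 ≤ y₀ / F.δ ∧ y₀ / F.δ < b₀ := by
    rw [hb₀]; push_cast; exact ⟨by linarith [Int.floor_le (y₀ / F.δ)], Int.lt_floor_add_one _⟩
  have pb₁ : (b₁ : ℝ) < (y₀ + Ly) / F.δ ∧ (y₀ + Ly) / F.δ ≤ b₁ + 1 := by
    rw [hb₁]; push_cast; exact ⟨by linarith [Int.ceil_lt_add_one ((y₀ + Ly) / F.δ)], by linarith [Int.le_ceil ((y₀ + Ly) / F.δ)]⟩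
  have hLxδ : (x₀ + Lx) / F.δ = x₀ / F.δ + Lx / F.δ := add_div _ _ _
  have hLyδ : (y₀ + Ly) / F.δ = y₀ / F.δ + Ly / F.δ := add_div _ _ _
  have hLxR : 16 * R ≤ Lx / F.δ := by rw [hR, ← mul_div_assoc]; exact div_le_div_of_nonneg_right (by linarith) hδ.le
  have hLyR : 16 * R ≤ Ly / F.δ := by rw [hR, ← mul_div_assoc]; exact div_le_div_of_nonneg_right (by linarith) hδ.le
  have hzΩ' : (x₀ < z.re ∧ z.re < x₀ + Lx) ∧ (y₀ < z.im ∧ z.im < y₀ + Ly) := by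
    rw [hΩ, Complex.mem_reProdIm, Set.mem_Ioo, Set.mem_Ioo] at hzΩ; exact hzΩ
  have hzre : x₀ / F.δ < z'.re ∧ z'.re < (x₀ + Lx) / F.δ := by
    rw [hz're]; exact ⟨div_lt_div_of_pos_right hzΩ'.1.1 hδ, div_lt_div_of_pos_right hzΩ'.1.2 hδ⟩
  have hzim : y₀ / F.δ < z'.im ∧ z'.im < (y₀ + Ly) / F.δ := by
    rw [hz'im]; exact ⟨div_lt_div_of_pos_right hzΩ'.2.1 hδ, div_lt_div_of_pos_right hzΩ'.2.2 hδ⟩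
  -- distances to the side-lines, the near side, the sector radius
  have hside4 := ufrs_rect_nearSide x₀ (x₀ + Lx) y₀ (y₀ + Ly) z s (by rw [← hΩ]; exact hzΩ) (by rw [← hΩ]; exact hinf)
  have hsδ : s / F.δ = r := hr.symm
  have hnear : z'.re - ((a₀ : ℝ) + 1 / 8) ≤ r ∨ ((a₁ : ℝ) - 1 / 8) - z'.re ≤ r ∨ z'.im - ((b₀ : ℝ) + 1 / 8) ≤ r ∨ ((b₁ : ℝ) - 1 / 8) - z'.im ≤ r := by
    rcases hside4 with h | h | h | h
    · refine Or.inl ?_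
      have : z'.re ≤ x₀ / F.δ + r := by rw [hz're, hr, ← add_div]; exact div_le_div_of_nonneg_right (by linarith) hδ.le
      linarith [pa₀.2]
    · refine Or.inr (Or.inl ?_)
      have : (x₀ + Lx) / F.δ - r ≤ z'.re := by rw [hz're, hr, ← sub_div]; exact div_le_div_of_nonneg_right (by linarith) hδ.le
      linarith [pa₁.1]
    · refine Or.inr (Or.inr (Or.inl ?_))
      have : z'.im ≤ y₀ / F.δ + r := by rw [hz'im, hr, ← add_div]; exact div_le_div_of_nonneg_right (by linarith) hδ.le
      linarith [pb₀.2]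
    · refine Or.inr (Or.inr (Or.inr ?_))
      have : (y₀ + Ly) / F.δ - r ≤ z'.im := by rw [hz'im, hr, ← sub_div]; exact div_le_div_of_nonneg_right (by linarith) hδ.le
      linarith [pb₁.1]
  obtain ⟨R₁, hR₁, hadL, hadR, hadB, hadT⟩ := adapt_HTP (z'.re - ((a₀ : ℝ) + 1 / 8)) (((a₁ : ℝ) - 1 / 8) - z'.re)
    (z'.im - ((b₀ : ℝ) + 1 / 8)) (((b₁ : ℝ) - 1 / 8) - z'.im) r R hr1 hRr hnear (by linarith [pa₀.2, pa₁.1]) (by linarith [pb₀.2, pb₁.1])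
  have hR₁lo : R / 6 ≤ R₁ := by rcases hR₁ with rfl | rfl <;> linarith
  have hR₁hi : R₁ ≤ R / 2 := by rcases hR₁ with rfl | rfl <;> linarith
  -- window and scale, monochromatic boundary, connected exterior, arms
  obtain ⟨m, R', hm_one, hm1, hm200, hmR, hR'R₁, hR200, hr0, hrR₁, h3, hR₁R⟩ := numerics_HTP r R R₁ hr1 hRr hR₁lo hR₁hi
  have hcol := ufrs_rect_boundaryMonochromatic F x₀ (x₀ + Lx) y₀ (y₀ + Ly) (by linarith) (by linarith) hΩ hF z S hδS
    (by rw [show x₀ + Lx - x₀ = Lx by ring, show y₀ + Ly - y₀ = Ly by ring]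
        exact le_min (by linarith) (by linarith)) hnoAB
  have hZc : IsPreconnected (exteriorSet z' r R₁ a₀ a₁ b₀ b₁) :=
    annulus_exterior_preconnected z' r R₁ a₀ a₁ b₀ b₁ hr0 h3 (by linarith [pa₀.2, pa₁.1])
      (by linarith [pb₀.2, pb₁.1]) hadL hadR hadB hadT
  have harms := fun ω => arms_mesh_one_HTP hF hΩ z (s := s) (S := S) hr hR hr0 hrR₁ hR₁R hcol hZc ω
  -- numeric conclusions
  have hmδ : (m : ℝ) * F.δ ≤ 200 * s := by
    have e : s = r * F.δ := by rw [hr, div_mul_cancel₀ _ hδ.ne']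
    rw [e, ← mul_assoc]; exact mul_le_mul_of_nonneg_right hm200 hδ.le
  have hSR' : S ≤ 200 * R' * F.δ := by
    have e : S = R * F.δ := by rw [hR, div_mul_cancel₀ _ hδ.ne']
    rw [e]; exact mul_le_mul_of_nonneg_right hR200 hδ.le
  -- common coordinate estimates for the base site
  have hbase : ∀ (p : Site 2) (cz cw : ℝ), |(p 0 : ℝ) - z'.re| ≤ cz → |(p 1 : ℝ) - z'.im| ≤ cw → cz + cw ≤ r + 2 →
      dist (Site.toComplex p) z' ≤ r + 2 := fun p cz cw h1 h2 h3 => (dist_site_le_HTP p z').trans (by linarith)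
  have hfl_re : |((⌊z'.re⌋ : ℤ) : ℝ) - z'.re| ≤ 1 :=
    abs_le.2 ⟨by linarith [Int.lt_floor_add_one z'.re], by linarith [Int.floor_le z'.re]⟩
  have hfl_im : |((⌊z'.im⌋ : ℤ) : ℝ) - z'.im| ≤ 1 :=
    abs_le.2 ⟨by linarith [Int.lt_floor_add_one z'.im], by linarith [Int.floor_le z'.im]⟩
  -- the frame of the near side
  rcases hside4 with h | h | h | h
  · -- left side
    have hzr : |(a₀ : ℝ) - z'.re| ≤ r := by
      have : z'.re ≤ x₀ / F.δ + r := by rw [hz're, hr, ← add_div]; exact div_le_div_of_nonneg_right (by linarith) hδ.le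
      exact abs_le.2 ⟨by linarith [pa₀.2], by linarith [pa₀.1, hzre.1]⟩
    refine ⟨frameL a₀, ⌊z'.im⌋, m, R', hm_one, hmδ, hSR', fun ω hω => ?_⟩
    obtain ⟨κ, x, y, W, hne, harm, hpw⟩ := harms ω hω
    obtain ⟨g1, g2, g3, g4, g5, g6, g7⟩ := frameSpecL_HTP hF hΩ ⌊z'.im⌋
    exact frame_hpLooseArms_HTP (frameL a₀) (frameL a₀) g1 1 0 (by decide) g2 g3 g4 (meshVertices F.Ω F.δ) F.IsInnerFace g5 g6
      z' r R₁ ⌊z'.im⌋ ![a₀, ⌊z'.im⌋] g7 (hbase _ r 1 (by simpa using hzr) (by simpa using hfl_im) (by linarith))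
      m R' hm1 hmR hR'R₁ ω κ x y W hne harm hpw
  · -- right side
    have hzr : |(a₁ : ℝ) - z'.re| ≤ r := by
      have : (x₀ + Lx) / F.δ - r ≤ z'.re := by rw [hz're, hr, ← sub_div]; exact div_le_div_of_nonneg_right (by linarith) hδ.le
      exact abs_le.2 ⟨by linarith [pa₁.2, hzre.2], by linarith [pa₁.1]⟩
    refine ⟨frameR a₁, ⌊z'.im⌋, m, R', hm_one, hmδ, hSR', fun ω hω => ?_⟩
    obtain ⟨κ, x, y, W, hne, harm, hpw⟩ := harms ω hω
    obtain ⟨g1, g2, g3, g4, g5, g6, g7⟩ := frameSpecR_HTP hF hΩ ⌊z'.im⌋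
    exact frame_hpLooseArms_HTP (frameR a₁) (faceR a₁) g1 1 0 (by decide) g2 g3 g4 (meshVertices F.Ω F.δ) F.IsInnerFace g5 g6
      z' r R₁ ⌊z'.im⌋ ![a₁, ⌊z'.im⌋] g7 (hbase _ r 1 (by simpa using hzr) (by simpa using hfl_im) (by linarith))
      m R' hm1 hmR hR'R₁ ω κ x y W hne harm hpw
  · -- bottom side
    have hzi : |(b₀ : ℝ) - z'.im| ≤ r := by
      have : z'.im ≤ y₀ / F.δ + r := by rw [hz'im, hr, ← add_div]; exact div_le_div_of_nonneg_right (by linarith) hδ.le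
      exact abs_le.2 ⟨by linarith [pb₀.2], by linarith [pb₀.1, hzim.1]⟩
    refine ⟨frameB b₀, ⌊z'.re⌋, m, R', hm_one, hmδ, hSR', fun ω hω => ?_⟩
    obtain ⟨κ, x, y, W, hne, harm, hpw⟩ := harms ω hω
    obtain ⟨g1, g2, g3, g4, g5, g6, g7⟩ := frameSpecB_HTP hF hΩ ⌊z'.re⌋
    exact frame_hpLooseArms_HTP (frameB b₀) (frameB b₀) g1 0 1 (by decide) g2 g3 g4 (meshVertices F.Ω F.δ) F.IsInnerFace g5 g6
      z' r R₁ ⌊z'.re⌋ ![⌊z'.re⌋, b₀] g7 (hbase _ 1 r (by simpa using hfl_re) (by simpa using hzi) (by linarith))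
      m R' hm1 hmR hR'R₁ ω κ x y W hne harm hpw
  · -- top side
    have hzi : |(b₁ : ℝ) - z'.im| ≤ r := by
      have : (y₀ + Ly) / F.δ - r ≤ z'.im := by rw [hz'im, hr, ← sub_div]; exact div_le_div_of_nonneg_right (by linarith) hδ.le
      exact abs_le.2 ⟨by linarith [pb₁.2, hzim.2], by linarith [pb₁.1]⟩
    refine ⟨frameT b₁, ⌊z'.re⌋, m, R', hm_one, hmδ, hSR', fun ω hω => ?_⟩
    obtain ⟨κ, x, y, W, hne, harm, hpw⟩ := harms ω hω
    obtain ⟨g1, g2, g3, g4, g5, g6, g7⟩ := frameSpecT_HTP hF hΩ ⌊z'.re⌋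
    exact frame_hpLooseArms_HTP (frameT b₁) (faceT b₁) g1 0 1 (by decide) g2 g3 g4 (meshVertices F.Ω F.δ) F.IsInnerFace g5 g6
      z' r R₁ ⌊z'.re⌋ ![⌊z'.re⌋, b₁] g7 (hbase _ 1 r (by simpa using hfl_re) (by simpa using hzi) (by linarith))
      m R' hm1 hmR hR'R₁ ω κ x y W hne harm hpw

end

end Summit.CriticalPhenomena.CardyFormulaZ2.Cruxes.EdgePrecompact.QkzStripBoundaryArm
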